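import Mathlib
import HarnessLib
import HarnessLib.Audit
import Summits.AtomisticToContinuum.Statement
import Literature.MathematicalPhysics.StatisticalMechanics.LennardJonesClusters
import Summits.AtomisticToContinuum.Crystallization.Theorems.ExcessDecayLiouvilleCrysEnergyLimit
import Summits.AtomisticToContinuum.Crystallization.Theorems.PricedLinkCensusChargedPeriodicIsOptimal
import Summits.AtomisticToContinuum.Crystallization.Theorems.PalmUnimodularRigidityChargedPatternCrystallizes
import HarnessLib.Audit.Status.Attr

/-!
Route: HolmgrenBoyleLind

DORMANT since 2026-08-25T13:59:55Z (reconciler: no traction for 7.8 d (last activity item-evidence-added at 2026-08-17T19:16:06Z); parked, not closed — `ledger route dormant route-AtomisticToContinuum-HolmgrenBoyleLind --off` to reactiv) — unstaffed, not closed; items shared with open routes are served there. `ledger route dormant <id> --off` reactivates.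

# Route HolmgrenBoyleLind — analytic-tail unique continuation + Boyle–Lind half-space rigidity make
FLC Lennard-Jones equilibria periodic

X = UC ∧ HSR ∧ LIM ("it suffices to show"), realising card holmgren-boyle-lind-analytic-tail
(ideator-17). UC (HalfSpaceUniqueContinuation): for a Delone set Λ ⊂ ℝ³ of finite local complexity
(FLC) in exact Lennard-Jones force balance, two elements of its patch-hull that coincide on an open
half-space coincide — unique continuation of the FIRST variation, powered by the analytic
inverse-power tail. HSR (HalfSpaceRigidityPeriodic, Boyle–Lind Thm 3.7 transcribed to FLC Delone
sets of ℝ³): an FLC Delone set no two distinct hull elements of which coincide on an open half-space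
is fully periodic. LIM (GroundStatesChargeFLCEquilibrium): every sequence of LJ ground states
charges, with positive density at every scale and frequently in N, the patches of ONE FLC Delone set
in force balance (force balance of local limits is automatic from finite-N criticality; the content
is cohesion + finite local complexity). UC ∧ HSR is the Literature-grade theorem
FLCEquilibriumPeriodic («an FLC Delone Lennard-Jones equilibrium in ℝ³ is a periodic crystal»: ideal
quasicrystals, substitution sets, Wang decorations, ideal aperiodic Barlow stackings are never in LJ
mechanical equilibrium); with LIM the charged set is periodic, and the shared surgery-attainment /
pattern-bookkeeping supports of BenjaminiSchrammGroundStates give both conjuncts.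
Lean: `HalfSpaceUniqueContinuation ∧ HalfSpaceRigidityPeriodic ∧ GroundStatesChargeFLCEquilibrium`

## Assembly
Pure logic plus the two PROVED Literature facts LennardJonesGroundStatesExist_holds,
LennardJonesMinimalDistance_holds and Mathlib's IsLeast.csInf_eq — sorry-free as `assembly_provable`
in the planner's SketchProofs.lean (lean check rc 0): given a ground-state sequence x, LIM gives Λ;
UC(Λ) is exactly the hypothesis of HSR, so Λ = P.points (subst), whence GroundStatesChargePeriodic;
ChargedPatternCrystallizes with the minimal-distance fact gives IsCrystallizing lennardJones 3; for
the energetic half a ground-state sequence exists (fact), its charged P is optimal by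
ChargedPeriodicIsOptimal (IsLeast), and CrysEnergyLimit rewritten by csInf_eq is Tendsto (E(N)/N) (𝓝
e(P)); the pair is HasPeriodicGroundStateEnergy ∧ IsCrystallizing = Crystallization (the sub-problem
constant is the abbrev of this Literature statement).

Rationale: WHY THIS LINE. The mechanism uses the two features that make Lennard-Jones hard — the singular core
and the non-localisable analytic tail — as the resource: the difference field of two equilibria is
real-analytic with a convergent inverse-power expansion at infinity, so a rearrangement "cannot hide
from infinity" (FiniteRigidity, provable now), and the conjectured half-space version UC turns every
hyperplane of an FLC equilibrium hull expansive; Boyle–Lind's theorem (BoyleLind1997 Thm 3.7: an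
infinite compact ℤᵈ-system, d ≥ 2, has a nonexpansive hyperplane), the engine of the
ℤ²-periodicity/Nivat literature (CyrKra2015, KariSzabados2020) where it is fed by LOW COMPLEXITY, is
fed here by a PDE-type unique continuation instead, and its transcription HSR to patch-hulls of FLC
Delone sets (BaakeGrimm2013 §5.3–5.4, Lagarias1999DCG, LagariasPleasants2003; KellendonkLenz2013 is
the equicontinuous analogue) is a self-contained recentring-plus-compactness argument. Imported
areas: real-analytic continuation / antilocality of inverse-power kernels (arXiv:1609.09248;
discrete finite-range UC LiZhang2022 is the opposite, hard regime), multidimensional symbolic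
dynamics and aperiodic order (BoyleLind1997, BaakeGrimm2013), Hardy-space boundary uniqueness for
the linearised test (Katznelson2004 III.3.13). What it does that the open routes do not:
CrystalLocalRigidity, CrystalKissingRigidity, CrystalThreeCone and PoissonBesselStacking identify
the winner (relaxed hcp) through certified local inequalities and stacking selection, and
BenjaminiSchrammGroundStates asks directly that stationary minimisers charge a periodic Q; this line
never names a structure and uses no energy comparison until the final surgery lemma — it converts
«limits have finite local complexity» into periodicity by rigidity, so the problem-specific input
LIM is FLC + cohesion, strictly weaker than periodicity (BlancLewin2015 §2.3: open in d = 3).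
Negatives index empty at filing.

RANKED CRUXES. #0 Target (target) — X = UC ∧ HSR ∧ LIM as in § Thesis. (why it might fail: LIM is an
exact finite-local-complexity statement about ground-state limits, of crystallization strength; UC
is open beyond its linearisation (settled this session) and the finite case (FiniteRigidity).)
[BoyleLind1997, BlancLewin2015]
#2 HalfSpaceUniqueContinuation (crux) — (card item U2, hull form) Let Λ ⊂ ℝ³ be δ-separated and
r-dense (Delone), of finite local complexity (for every R finitely many R-patches {v : x + v ∈ Λ,
‖v‖ ≤ R}, x ∈ Λ) and in exact Lennard-Jones force balance (for every x ∈ Λ the sum over y ∈ Λ ∖ x of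
V'(|x−y|)(x−y)/|x−y| converges to 0, V = r⁻¹²/12 − r⁻⁶/6, written with deriv lennardJones and
HasSum). If ω, ω' lie in the patch-hull of Λ (every closed ball of ω about 0 is an exact translate
of a Λ-patch) and agree on an open half-space {z : ⟨z,u⟩ < a}, u ≠ 0, then ω = ω'. Heuristic: the
signed difference sheet above the plane generates below it a real-analytic force field, a
superposition of in-plane Fourier modes with locked horizontal oscillation / vertical decay; force
balance puts every deep atom of the relatively dense set ω ∩ H at a common zero of all three
components, which kills the modes one by one; the continuum near k = 0 (slowly varying fields
sampled on a 1-dense set: Remez / Logvinenko–Sereda) is the technical front. The LINEARISATION about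
any lattice holds (see § Cheapest falsifier) and the finite case is FiniteRigidity. [difficulty: XL]
(why it might fail: two hull elements glued along a plane with EXACT cancellation below would refute
it; the in-plane spectrum of the difference sheet accumulates at k = 0 (polynomial, not modal,
decay), so mode-by-mode arguments do not close; only the linearised and the finite-difference cases
are in hand.) [BoyleLind1997, LiZhang2022, Katznelson2004, arXiv:1609.09248, BlancLewin2015]
#3 GroundStatesChargeFLCEquilibrium (crux) — (card item U4, charged form) for every sequence of
Lennard-Jones ground states x^N in ℝ³ there is ONE set Λ ⊂ ℝ³, δ-separated, r-dense, of finite local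
complexity and in exact LJ force balance, such that for all R, ε > 0 there is ρ > 0 with, for
infinitely many N, at least ρN particles i whose R-neighbourhood in x^N is two-way ε-matched with
x_i + A(Λ ∩ B_R(q) − q) for some linear isometry A and some base point q ∈ Λ. Force balance of such
a Λ is automatic (finite-N criticality ∇E = 0 plus the O(R⁻⁴) force tail of a separated set), so the
content is: a Benjamini–Schramm / Palm limit of the rooted ground states is carried, with positive
mass, by the patches of one FLC Delone set — cohesion (NoFoam, item 2912 of
BenjaminiSchrammGroundStates) plus finite local complexity of the limit, strictly weaker than
periodicity (quasicrystalline or Wang-type limits would still satisfy it). [difficulty: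
open-problem] (why it might fail: exact FLC of local limits is a rigidity statement of
crystallization strength: amorphous/polytetrahedral limits, a continuum of relaxed local
environments (Cantor sets of fault spacings), or foam (cohesion unproved, BlancLewin2015 §2.2) kill
it.) [BlancLewin2015, Theil2006, FlatleyTheil2015, arXiv:2604.19239, Radin1991, AldousSteele2004]
#4 HalfSpaceRigidityPeriodic (crux) — (card item U3: Boyle–Lind Thm 3.7 transcribed to FLC Delone
sets of ℝ³ in patch-hull form) Let Λ ⊂ ℝ³ be δ-separated, r-dense and of finite local complexity. If
no two distinct elements of the patch-hull of Λ agree on an open half-space, then Λ is the point set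
F + G of a periodic configuration (full-rank lattice G, finite motif F). Intended proof
(contrapositive): if rank per(Λ) < 3, pigeonhole over the finitely many R-patch classes gives p, q ∈
Λ with equal R-patches and q − p ∉ per(Λ), so Λ − p ≠ Λ − q agree on B_R(0); recentre both at the
nearest point where they are c-apart in the local metric (it exists, at distance ≥ R − C → ∞); FLC
compactness of the hull (BaakeGrimm2013 Lemma 5.4, Prop. 5.4) yields limits η ≠ η' (c-apart at 0)
that are c-close on an open half-space, and for FLC sets c-closeness on a connected region is exact
agreement up to ONE small translation; per(·) a lattice + uniform discreteness then gives F + G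
(BaakeGrimm2013 Prop. 3.1). No ℤ³-action and no d ≥ 2 hypothesis is needed in this form.
[difficulty: L] (why it might fail: transcription risk: Boyle–Lind is for ℤᵈ-actions on compact
spaces, the ℝ³-hull has a Cantor transversal and no canonical ℤ³-action; robust distinctness of the
limit pair and «c-close on a ball ⇒ equal up to one small translation» need FLC bookkeeping not in
Mathlib.) [BoyleLind1997, BaakeGrimm2013, KellendonkLenz2013, Lagarias1999DCG,
LagariasPleasants2003, CyrKra2015]
#9 FiniteRigidity (support) — (card item U1, «a local rearrangement cannot hide from infinity») if Λ
⊂ ℝ³ is δ-separated, r-dense and in exact LJ force balance and Λ' ≠ Λ differs from Λ in finitely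
many points, then some point of Λ' is NOT in force balance in Λ'. Proof: the force difference Φ of
the finite signed source Λ'ΔΛ is real-analytic off the sources with a convergent expansion Σ_(n≥7)
H_n in terms homogeneous of degree −n for |x| large (binomial series of |x−y|^(−s)); if every point
of Λ' were balanced, Φ would vanish on the Delone set Λ ∩ Λ' near infinity, and since every
direction is a limit direction the H_n die one by one, so Φ ≡ 0 near infinity and hence on the
connected set ℝ³ ∖ (Λ'ΔΛ) (identity theorem, Mathlib
AnalyticOnNhd.eqOn_zero_of_preconnected_of_eventuallyEq_zero) — contradicting the uncancelled r⁻¹³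
core at a source. Fails exactly for finite-range V (no continuation past the cut-off) and for
band-limited potentials (no inverse-power expansion, no core): the catalogue's two
aperiodic-ground-state classes. [difficulty: M] [BlancLewin2015, HormanderALPDO1]
#9 FLCEquilibriumPeriodic (support) — (the card's headline Literature theorem; it is the glue UC →
HSR → this, sorry-free in the planner's SketchProofs.lean, so it closes when UC and HSR close and
may be attacked directly) every δ-separated, r-dense subset of ℝ³ of finite local complexity in
exact Lennard-Jones force balance is the point set of a periodic configuration. Corollaries: ideal
icosahedral model sets, substitution/cut-and-project vertex sets, Wang-tile decorations of lattices
and ideal aperiodic close-packed (kissing-12) stackings are never in LJ mechanical equilibrium;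
relaxed aperiodic stackings are equilibria but not FLC (the card's foil), which fixes the scope.
[difficulty: XL] [BoyleLind1997, KellendonkLenz2013, BaakeGrimm2013]
#9 GroundStatesChargePeriodic (support) — (shared with BenjaminiSchrammGroundStates, item 2911 —
there a crux, here the intermediate LIM ∧ UC ∧ HSR ⇒ this, see SketchProofs.lean) for every sequence
of LJ ground states in ℝ³ there is ONE periodic configuration Q such that for all R, ε > 0 there is
ρ > 0 with, for infinitely many N, at least ρN particles whose R-neighbourhood is two-way ε-matched
with an isometric copy of a Q-patch based at a point of Q. [difficulty: XL] [BlancLewin2015,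
AldousSteele2004]
#9 ChargedPeriodicIsOptimal (support) — (shared, item 2913: SURGERY-ATTAINMENT) a periodic
configuration Q charged with positive density at every scale by some sequence of LJ ground states
has the least energy per particle among all periodic configurations (excise charged Q-patches,
insert Q'-patches with unit margin, compare with E(M)/M → e_∞ ≤ e(Q')): conjunct (i)'s attainment
without identifying the minimiser. [difficulty: M] [BlancLewin2015]
#9 ChargedPatternCrystallizes (support) — (shared, item 2916: soft bookkeeping)
GroundStatesChargePeriodic together with the uniform minimal distance of LJ ground states gives
IsCrystallizing lennardJones 3: pick scales (k, 1/k), good particles, align isometries along a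
subsequence (compactness of O(3)); two-way matching + minimal distance is eventually exact near
every compact set, and PeriodicConfiguration.tendsto_sum_of_eventually_near' (in tree) gives local
convergence, multiplicity 1. [difficulty: M] [BlancLewin2015]
#9 CrysEnergyLimit (support) — (shared, item 0626: bookkeeping) E(N)/N converges to the infimum over
periodic configurations of the LJ energy per particle in d = 3: the limit e_∞ exists (BlancLewin2015
(8), proved in tree), e_∞ ≤ e(Q) by periodic trial blocks, and e(Q_N) ≤ E(N)/N by periodising a
ground state with a unit empty margin (all cross terms attractive). [difficulty: M] [BlancLewin2015]

TWO-LAYER PLAN. Foreseen glued splits (k ≤ 3, depth 1), none filed now. UC ⇐ UCContinuum (the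
difference field vanishes on an OPEN subset of the lower half-space ⇒ ω = ω': identity theorem on
the connected complement of a discrete set + uncancelled core; provable now) → UCDiscrete (a vector
force field generated by a separated signed sheet above the plane that vanishes on a relatively
dense set at all depths below vanishes on an open set: the Remez / Logvinenko–Sereda front) → UC.
LIM ⇐ NoFoam (cohesion, = item 2912) → PalmLimitFLC (some Benjamini–Schramm limit law of the rooted
ground states gives positive mass to the patch-hull of one FLC set) → LIM (glue: finite-N
criticality ⇒ force balance of limits; portmanteau ⇒ charging). HSR ⇐ PatchHullCompact (FLC ⇒
sequential compactness of the patch-hull and «c-close on a ball ⇒ equal up to one small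
translation») → RecentredPair (non-full-rank periods ⇒ a distinct half-space-coincident pair) → HSR.

KILL CRITERIA. A pair of distinct patch-hull elements of an FLC Delone LJ-equilibrium agreeing on an
open half-space (¬UC) closes the route (`close --reason refuted:HalfSpaceUniqueContinuation`),
unless the witness is of a kind LIM visibly excludes — then one restate of UC to hulls arising as
ground-state limits. ¬HSR can only be a transcription slip: restate once (strip form / explicit
compactness hypothesis), else close. ¬LIM (e.g. a theorem that LJ ground-state limits carry a
continuum of local environments, or foam) closes the route and is negative knowledge for every
hull/FLC card; a refutation of the shared GroundStatesChargePeriodic (2911) kills this line together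
with BenjaminiSchrammGroundStates. Mooted by: BulkDefectVanish (0751) proved elsewhere (take Λ =
relaxed hcp in LIM), or CrysPeriodicMinAttained + IsCrystallizing proved by any route.

NOT DECOMPOSED YET. The general (non-hull) statement «two Delone LJ-equilibria of ℝ³ equal on an
open half-space are equal» and its d-dimensional / Mie (n, m) versions — stronger Literature
statements deliberately NOT filed (a wild non-FLC counterexample would break the route without
touching the assembly); the card's FOIL (for every Hägg word a unique nearby sequence of layer
spacings makes the relaxed Barlow stacking an exact, non-FLC equilibrium; needs relaxed-spacing
Barlow definitions); the linearised-UC lemma as a formal item (dynamical matrix not identically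
singular along the normal ⇒ no half-space-supported bounded lattice-statics solution); hull
infrastructure (local topology, patch-hull compactness, hull elements of an equilibrium are
equilibria — an O(R⁻⁴) tail lemma). Provers attach these with --supports; children are filed only
when a crux closes.

CHEAPEST FALSIFIER. The linearised hcp/fcc test requested by the novelty audit (R7/refuter-12): does
the full-tail force-constant system of a lattice admit a bounded solution supported on a half-space
of layers? Run on paper this session — NO: the layer Fourier transform turns linearised balance at
ALL layers into 𝔻(k,θ)·Û(k,θ) = 0, where Û(k,·) = Σ_(n≥0) û_n(k)e^(inθ) is the boundary value of a
tempered analytic function in the disc and 𝔻 is the phonon dynamical matrix, analytic in θ on (0,2π)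
for inverse-power tails (polylogarithmic layer couplings; exponentially decaying for k ≠ 0); det
𝔻(k,·) ≢ 0 for each k ⇒ Û(k,·) = 0 on an arc ⇒ Û ≡ 0 (F. and M. Riesz / one-variable
edge-of-the-wedge, Katznelson2004 III.3.13), first for k ≠ 0, then for k = 0. So the cheapest kill
FAILED to kill. Next cheapest: (a) a kit computation gluing half-infinite relaxed hcp to another
relaxed stacking, checking that no interface profile leaves the hcp half EXACTLY unrelaxed (registry
couplings ≈ e^(−5.9k) ≠ 0 say it cannot); (b) a tiling-space Boyle–Lind 3.7 in print (makes HSR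
`known`, no kill); (c) for LIM, an equal-energy LJ competitor family with a continuum of exact local
environments.

NUMBERS. V = r⁻¹²/12 − r⁻⁶/6, V'(r)/r = r⁻⁸ − r⁻¹⁴ (force on x: Σ_y (r⁻⁸ − r⁻¹⁴)(x − y)); force tail
beyond radius R from a δ-separated set: O(δ⁻³R⁻⁴); minimal distance in LJ ground states δ = 1/3
(LennardJonesMinimalDistance_holds); registry-dependent (k ≠ 0) interlayer couplings ≈ e^(−2πh|ξ₁|k)
≈ e^(−5.9k) versus registry-blind k⁻⁴ (route PoissonBesselStacking) — the two scales a UC proof must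
separate; expansion of the finite-source difference field starts at degree −7; Boyle–Lind Thm 3.7:
infinite compact ℤᵈ-system, d ≥ 2 ⇒ a nonexpansive (d−1)-plane; items at open: 11 (3 cruxes, 1
target, 6 supports of which 4 shared with BenjaminiSchrammGroundStates, 1 assembly).

DEFINITION REQUESTS. None filed at open: Delone (δ-separated + r-dense), FLC, patch-hull membership
and LJ force balance (HasSum of deriv lennardJones (dist x y) / dist x y • (x − y)) are inlined,
because Mathlib has only the bundled `Delone.DeloneSet` and no local topology on point sets; if
UC/HSR provers ask, request `IsFLC`, `patchHull`, `IsLJForceBalanced` under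
Literature/MathematicalPhysics/StatisticalMechanics in tenure. Acquisition pending: BoyleLind1997
full text (acq-02354; AMS rate-limited), not blocking.

Novelty: Searches (2026-08-15): `lit search --source crossref "expansive subdynamics tiling space"` (14 rows:
BoyleLind1997, Einsiedler–Lind–Miles–Ward 2001, rest noise); `lit search --source crossref
"equicontinuous Delone dynamical systems finite local complexity crystallographic"` (12:
KellendonkLenz2013, Lee–Solomyak 2019, Baake–Lenz–van Enter 2014, Klassert–Lenz–Stollmann 2011);
`lit search --source crossref "Cyr Kra nonexpansive Z2 subdynamics"` (8: CyrKra2015,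
KariSzabados2020, Colle 2023 one-sided nonexpansive directions); `lit search --source crossref
"geometric models for quasicrystals Delone sets of finite type"` (10: Lagarias1999DCG,
LagariasPleasants2003, Solomyak 1998); `lit search --source crossref "uniqueness lattice statics
half-space discrete elliptic Cauchy problem Wiener-Hopf"` (10, none on lattice equilibria); `lit
frontier AtomisticToContinuum --since 2020` (30 rows; crystallization side only arXiv:2407.20762 and
arXiv:2604.19239 — rigidity/polycrystals, no unique continuation, no subdynamics); `lit bridges
AtomisticToContinuum --cross any` (30 rows, none relevant); `lit galaxy search "expansive
subdynamics" --star all` (panama 4: Lind–Marcus textbook, two LNCS volumes, a biography; pdf 0;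
crabby 0; a further `--star pdf "nonexpansive"` query was refused, galaxyd saturated); local
searchd, OpenAlex and arXiv were unavailable this session (rc 75 / HTTP 429), so the card's own
sweep (ideator-17 and refuter-12 over zbMATH/crossref: no expansiveness-from-unique-conti  [refs: 10.1090/s0002-9947-97-01634-6, 2407.20762, 2604.19239, 1609.09248, doi:10.1090/s0002-9947-97-01634-6, BoyleLind1997, KellendonkLenz2013, CyrKra2015, KariSzabados2020, LagariasPleasants2003, BaakeGrimm2013, Katznelson2004, LiZhang2022, BlancLewin2015]

Barriers (technique_class: unique-continuation analytic-tail expansive-subdynamics): - technique_class: unique-continuation analytic-tail expansive-subdynamics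
- Literature.Barriers.AtomisticToContinuum.AperiodicTilingGroundStates: evaded by hypothesis class,
and explained — Berger–Radin–Miękisz models are finite-range lattice gases, where the difference
field has no continuation past the cut-off and FiniteRigidity is false; every statement of this
route uses the inverse-power analytic tail of V_LJ and continuum positions.
- Literature.Barriers.AtomisticToContinuum.SutoDegenerateGroundStates: consistent — Sütő's
band-limited φ has an oscillatory cos(K₀r)/r⁴ tail with no inverse-power expansion and no core
singularity, precisely the two ingredients FiniteRigidity/UC use; unions of incommensurate lattices
stay in force balance there by Poisson summation, which is impossible for r⁻¹²/12 − r⁻⁶/6.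
- Literature.Barriers.AtomisticToContinuum.Hubbard1978_mostHomogeneous: respected — a
one-dimensional LATTICE model selected by minimality, not criticality; the route's statements are
about continuum force balance in ℝ³ and say nothing about lattice gases.
- Literature.Barriers.AtomisticToContinuum.KissingTwelveDegeneracy: not engaged — no contact graph,
kissing configuration, cluster or stacking energy is compared; ideal aperiodic kissing-12 stackings
are excluded as equilibria by FLCEquilibriumPeriodic, relaxed ones are equilibria but non-FLC (the
card's foil), so the barrier's witnesses sit exactly on the boundary of the hypothesis class.
- Literature.Barriers.Atomist

History (route lifecycle, newest last):
- 2026-08-15T16:15:29Z · rev 3: dropped Target — route-repair cleanup: drop Target (stmt-6074). Its statement 'HalfSpaceUniqueContinuation ∧ HalfSpaceRigidityPeriodic ∧ GroundStatesChargeFLCEquilibrium' names (planner-rbadge-AtomisticToContinuum-HolmgrenBo-b506767e-g2-0)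
- 2026-08-25T13:59:55Z · DORMANT — reconciler: no traction for 7.8 d (last activity item-evidence-added at 2026-08-17T19:16:06Z); parked, not closed — `ledger route dormant route-AtomisticToConti (operator:999:3423437)

sub-problem: Crystallization · status: dormant · opened planner-plancard-AtomisticToContinuum-Crystal-47e4a50e-0 2026-08-15T11:44:27Z · rev 5 · ledger route-AtomisticToContinuum-HolmgrenBoyleLind
GENERATED by the gate from the ledger (D-0016/17). Provers cite these decls: `theorem foo : Summit.AtomisticToContinuum.Crystallization.Theses.HolmgrenBoyleLind.<Decl> := …` in Summits/AtomisticToContinuum/Crystallization/Theorems/<Name>.lean.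
-/

namespace Summit.AtomisticToContinuum.Crystallization.Theses.HolmgrenBoyleLind

open scoped BigOperators Topology Manifold Classical MeasureTheory ProbabilityTheory Matrix InnerProductSpace ComplexConjugate ContinuousMap
open Filter Set Function TopologicalSpace MeasureTheory

attribute [summit_statement] _root_.Crystallization

/-- item stmt-AtomisticToContinuum-6075 · crux · rank 2 · open · by planner
why it might fail: Given elementary HSR, UC ⟺ 'every FLC Delone exact LJ equilibrium of ℝ³ is periodic': open (BlancLewin2015 §2.3 p.7). One aperiodic FLC equilibrium kills it; cheapest: layered S×L₂ (in-plane forces die by symmetry ⇒ 1D balance, finite gap alphabet). Riesz antilocality needs an OPEN zero set.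
sources: BlancLewin2015, arXiv:1504.01153, arXiv:1609.09248, Suto2006, EngelTrebin2007, LiZhang2022
[crux] (card item U2, hull form) Let Λ ⊂ ℝ³ be δ-separated and r-dense (Delone), of finite local
complexity (for every R finitely many R-patches {v : x + v ∈ Λ, ‖v‖ ≤ R}, x ∈ Λ) and in exact
Lennard-Jones force balance (for every x ∈ Λ the sum over y ∈ Λ ∖ x of V'(|x−y|)(x−y)/|x−y|
converges to 0, V = r⁻¹²/12 − r⁻⁶/6, written with deriv lennardJones and HasSum). If ω, ω' lie in
the patch-hull of Λ (every closed ball of ω about 0 is an exact translate of a Λ-patch) and agree on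
an open half-space {z : ⟨z,u⟩ < a}, u ≠ 0, then ω = ω'. Heuristic: the signed difference sheet above
the plane generates below it a real-analytic force field, a superposition of in-plane Fourier modes
with locked horizontal oscillation / vertical decay; force balance puts every deep atom of the
relatively dense set ω ∩ H at a common zero of all three components, which kills the modes one by
one; the continuum near k = 0 (slowly varying fields sampled on a 1-dense set: Remez /
Logvinenko–Sereda) is the technical front. The LINEARISATION about any lattice holds (see § Cheapest
falsifier) and the finite case is FiniteRigidity. [difficulty: XL] -/
@[route_item "route-AtomisticToContinuum-HolmgrenBoyleLind", crux]
def HalfSpaceUniqueContinuation : Prop :=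
  ∀ (Λ : Set (EuclideanSpace ℝ (Fin 3))) (δ r : ℝ), 0 < δ → 0 < r → (∀ x ∈ Λ, ∀ y ∈ Λ, x ≠ y → δ ≤ dist x y) → (∀ c : EuclideanSpace ℝ (Fin 3), ∃ y ∈ Λ, dist y c ≤ r) → (∀ R : ℝ, Set.Finite {S : Set (EuclideanSpace ℝ (Fin 3)) | ∃ x ∈ Λ, S = {v : EuclideanSpace ℝ (Fin 3) | x + v ∈ Λ ∧ ‖v‖ ≤ R}}) → (∀ x ∈ Λ, HasSum (fun y : {y : EuclideanSpace ℝ (Fin 3) // y ∈ Λ ∧ y ≠ x} => (deriv Literature.MathematicalPhysics.StatisticalMechanics.lennardJones (dist x (y : EuclideanSpace ℝ (Fin 3))) / dist x (y : EuclideanSpace ℝ (Fin 3))) • (x - (y : EuclideanSpace ℝ (Fin 3)))) 0) → ∀ ω ω' : Set (EuclideanSpace ℝ (Fin 3)), (∀ R : ℝ, ∃ v : EuclideanSpace ℝ (Fin 3), {z : EuclideanSpace ℝ (Fin 3) | z ∈ ω ∧ ‖z‖ ≤ R} = {z : EuclideanSpace ℝ (Fin 3) | z + v ∈ Λ ∧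 ‖z‖ ≤ R}) → (∀ R : ℝ, ∃ v : EuclideanSpace ℝ (Fin 3), {z : EuclideanSpace ℝ (Fin 3) | z ∈ ω' ∧ ‖z‖ ≤ R} = {z : EuclideanSpace ℝ (Fin 3) | z + v ∈ Λ ∧ ‖z‖ ≤ R}) → ∀ (u : EuclideanSpace ℝ (Fin 3)) (a : ℝ), u ≠ 0 → (∀ z : EuclideanSpace ℝ (Fin 3), inner ℝ z u < a → (z ∈ ω ↔ z ∈ ω')) → ω = ω'

/-- item stmt-AtomisticToContinuum-6076 · crux · rank 3 · open · by planner
why it might fail: Needs cohesion (no foam; unproved, BlancLewin2015 §2.2) AND one FIXED FLC exact equilibrium Λ charged with density ρ(R,ε)>0 at every scale: a limit with a continuum of relaxed local environments (non-FLC fault spacings), amorphous bulk, or good fraction → 0 as R→∞ kills it. Crystallization strength.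
sources: BlancLewin2015, arXiv:1504.01153, Theil2006, FlatleyTheil2015, arXiv:2604.19239, Radin1991
[crux] (card item U4, charged form) for every sequence of Lennard-Jones ground states x^N in ℝ³
there is ONE set Λ ⊂ ℝ³, δ-separated, r-dense, of finite local complexity and in exact LJ force
balance, such that for all R, ε > 0 there is ρ > 0 with, for infinitely many N, at least ρN
particles i whose R-neighbourhood in x^N is two-way ε-matched with x_i + A(Λ ∩ B_R(q) − q) for some
linear isometry A and some base point q ∈ Λ. Force balance of such a Λ is automatic (finite-N
criticality ∇E = 0 plus the O(R⁻⁴) force tail of a separated set), so the content is: a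
Benjamini–Schramm / Palm limit of the rooted ground states is carried, with positive mass, by the
patches of one FLC Delone set — cohesion (NoFoam, item 2912 of BenjaminiSchrammGroundStates) plus
finite local complexity of the limit, strictly weaker than periodicity (quasicrystalline or
Wang-type limits would still satisfy it). [difficulty: open-problem] -/
@[route_item "route-AtomisticToContinuum-HolmgrenBoyleLind", crux]
def GroundStatesChargeFLCEquilibrium : Prop :=
  ∀ x : (N : ℕ) → (Fin N → EuclideanSpace ℝ (Fin 3)), (∀ N, Literature.MathematicalPhysics.StatisticalMechanics.IsGroundState Literature.MathematicalPhysics.StatisticalMechanics.lennardJones (x N)) → ∃ (Λ : Set (EuclideanSpace ℝ (Fin 3))) (δ r : ℝ), 0 < δ ∧ 0 < r ∧ (∀ x ∈ Λ, ∀ y ∈ Λ, x ≠ y → δ ≤ dist x y) ∧ (∀ c : EuclideanSpace ℝ (Fin 3), ∃ y ∈ Λ, dist y c ≤ r) ∧ (∀ R : ℝ, Set.Finite {S : Set (EuclideanSpace ℝ (Fin 3)) | ∃ x ∈ Λ, S = {v : EuclideanSpace ℝ (Fin 3) | x + v ∈ Λ ∧ ‖v‖ ≤ R}}) ∧ (∀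 x ∈ Λ, HasSum (fun y : {y : EuclideanSpace ℝ (Fin 3) // y ∈ Λ ∧ y ≠ x} => (deriv Literature.MathematicalPhysics.StatisticalMechanics.lennardJones (dist x (y : EuclideanSpace ℝ (Fin 3))) / dist x (y : EuclideanSpace ℝ (Fin 3))) • (x - (y : EuclideanSpace ℝ (Fin 3)))) 0) ∧ (∀ R ε : ℝ, 0 < R → 0 < ε → ∃ ρ : ℝ, 0 < ρ ∧ ∃ᶠ N : ℕ in Filter.atTop, ρ * (N : ℝ) ≤ (Nat.card {i : Fin N // ∃ A : EuclideanSpace ℝ (Fin 3) →ₗᵢ[ℝ] EuclideanSpace ℝ (Fin 3), ∃ q ∈ Λ, (∀ s ∈ Λ, dist s q ≤ R → ∃ j : Fin N, dist (x N j) (x N i + A (s - q)) ≤ ε) ∧ (∀ j : Fin N, dist (x N j) (x N i) ≤ R → ∃ s ∈ Λ, dist (x N j) (x N i + A (s - q)) ≤ ε)} : ℝ))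

/-- item stmt-AtomisticToContinuum-6077 · support · rank 4 · closed · proved by Summit.AtomisticToContinuum.Crystallization.Theorems.holmgrenBoyleLind_halfSpaceRigidityPeriodic_proof @ 58672f046ac3 (prover) · by planner
why it might fail: transcription risk only: the ℝ³ patch-hull has no ℤ³-action; needs FLC bookkeeping (exact local limits by patch pigeonhole, 'per(Λ) rank 3 + Delone ⇒ F+G', PeriodicConfiguration motif = coset representatives) not in Mathlib.
sources: BaakeGrimm2013, BoyleLind1997, LagariasPleasants2003, KellendonkLenz2013
[crux] (card item U3: Boyle–Lind Thm 3.7 transcribed to FLC Delone sets of ℝ³ in patch-hull form)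
Let Λ ⊂ ℝ³ be δ-separated, r-dense and of finite local complexity. If no two distinct elements of
the patch-hull of Λ agree on an open half-space, then Λ is the point set F + G of a periodic
configuration (full-rank lattice G, finite motif F). Intended proof (contrapositive): if rank per(Λ)
< 3, pigeonhole over the finitely many R-patch classes gives p, q ∈ Λ with equal R-patches and q − p
∉ per(Λ), so Λ − p ≠ Λ − q agree on B_R(0); recentre both at the nearest point where they are
c-apart in the local metric (it exists, at distance ≥ R − C → ∞); FLC compactness of the hull
(BaakeGrimm2013 Lemma 5.4, Prop. 5.4) yields limits η ≠ η' (c-apart at 0) that are c-close on an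
open half-space, and for FLC sets c-closeness on a connected region is exact agreement up to ONE
small translation; per(·) a lattice + uniform discreteness then gives F + G (BaakeGrimm2013 Prop.
3.1). No ℤ³-action and no d ≥ 2 hypothesis is needed in this form. [difficulty: L] -/
@[route_item "route-AtomisticToContinuum-HolmgrenBoyleLind", crux]
def HalfSpaceRigidityPeriodic : Prop :=
  ∀ (Λ : Set (EuclideanSpace ℝ (Fin 3))) (δ r : ℝ), 0 < δ → 0 < r → (∀ x ∈ Λ, ∀ y ∈ Λ, x ≠ y → δ ≤ dist x y) → (∀ c : EuclideanSpace ℝ (Fin 3), ∃ y ∈ Λ, dist y c ≤ r) → (∀ R : ℝ, Set.Finite {S : Set (EuclideanSpace ℝ (Fin 3)) | ∃ x ∈ Λ, S = {v : EuclideanSpace ℝ (Fin 3) | x + v ∈ Λ ∧ ‖v‖ ≤ R}}) → (∀ ω ω' : Set (EuclideanSpace ℝ (Fin 3)), (∀ R : ℝ, ∃ v : EuclideanSpace ℝ (Fin 3), {z : EuclideanSpace ℝ (Fin 3) | z ∈ ω ∧ ‖z‖ ≤ R} = {z : EuclideanSpace ℝ (Fin 3) | z + v ∈ Λ ∧ ‖z‖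 ≤ R}) → (∀ R : ℝ, ∃ v : EuclideanSpace ℝ (Fin 3), {z : EuclideanSpace ℝ (Fin 3) | z ∈ ω' ∧ ‖z‖ ≤ R} = {z : EuclideanSpace ℝ (Fin 3) | z + v ∈ Λ ∧ ‖z‖ ≤ R}) → ∀ (u : EuclideanSpace ℝ (Fin 3)) (a : ℝ), u ≠ 0 → (∀ z : EuclideanSpace ℝ (Fin 3), inner ℝ z u < a → (z ∈ ω ↔ z ∈ ω')) → ω = ω') → ∃ P : Literature.MathematicalPhysics.StatisticalMechanics.PeriodicConfiguration 3, P.points = Λ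

/-- item stmt-AtomisticToContinuum-0626 · support · rank 9 · closed · proved by Summit.AtomisticToContinuum.Crystallization.Theorems.crysEnergyLimit_proof @ de27d46e58f4 (prover) · by planner
Energetic crystallization: E(N)/N converges to the infimum over periodic (multi-lattice)
configurations of the LJ energy per particle in d = 3. Lower bound liminf ≥ ⨅ is the content ((a)
local optimality + (d) + surface term O(N^{2/3})); upper bound is filed separately. -/
@[route_item "route-AtomisticToContinuum-HolmgrenBoyleLind", crux]
def CrysEnergyLimit : Prop :=
  Filter.Tendsto (fun N : ℕ => Literature.MathematicalPhysics.StatisticalMechanics.groundStateEnergy Literature.MathematicalPhysics.StatisticalMechanics.lennardJones 3 N / N) Filter.atTop (nhds (⨅ Q : Literature.MathematicalPhysics.StatisticalMechanics.PeriodicConfiguration 3, Q.energyPerParticle Literature.MathematicalPhysics.StatisticalMechanics.lennardJones))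

/-- `CrysEnergyLimit` holds: proved by `Summit.AtomisticToContinuum.Crystallization.Theorems.crysEnergyLimit_proof` @ de27d46e58f4. -/
theorem CrysEnergyLimit_holds : CrysEnergyLimit := _root_.Summit.AtomisticToContinuum.Crystallization.Theorems.crysEnergyLimit_proof

/-- item stmt-AtomisticToContinuum-2911 · support · rank 9 · open · by planner
sources: BlancLewin2015, AldousSteele2004
[crux] (finite-N hinge; deterministic shadow of "the Benjamini–Schramm limit of the ground states
charges Q") for every sequence of LJ ground states x^N in ℝ³ there is ONE periodic configuration Q
such that for all R, ε > 0 there is ρ > 0 with, for infinitely many N, at least ρN particles i whose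
R-neighbourhood x^N ∩ B_R(x_i) is ε-matched both ways with x_i + A(Q.points − q) for some linear
isometry A and some base point q ∈ Q.points (base point in Q.points, not a fixed origin: no
vertex-transitivity is forced, cf. refuter note on 0751). Weaker than BulkDefectVanish 0751
(fraction → 1, fixed HCP): positive density, frequently in N, any periodic Q. [deps:
StationaryMinimisersChargePeriodic, NoFoam] [difficulty: XL] -/
@[route_item "route-AtomisticToContinuum-HolmgrenBoyleLind", crux]
def GroundStatesChargePeriodic : Prop :=
  ∀ x : (N : ℕ) → (Fin N → EuclideanSpace ℝ (Fin 3)), (∀ N, Literature.MathematicalPhysics.StatisticalMechanics.IsGroundState Literature.MathematicalPhysics.StatisticalMechanics.lennardJones (x N)) → ∃ Q : Literature.MathematicalPhysics.StatisticalMechanics.PeriodicConfiguration 3, ∀ R ε : ℝ, 0 < R → 0 < ε → ∃ ρ : ℝ, 0 < ρ ∧ ∃ᶠ N : ℕ in Filter.atTop, ρ * (N : ℝ) ≤ (Nat.card {i : Fin N // ∃ A : EuclideanSpace ℝ (Fin 3) →ₗᵢ[ℝ] EuclideanSpace ℝ (Fin 3), ∃ q ∈ Q.points, (∀ s ∈ Q.points,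 dist s q ≤ R → ∃ j : Fin N, dist (x N j) (x N i + A (s - q)) ≤ ε) ∧ (∀ j : Fin N, dist (x N j) (x N i) ≤ R → ∃ s ∈ Q.points, dist (x N j) (x N i + A (s - q)) ≤ ε)} : ℝ)

/-- item stmt-AtomisticToContinuum-2913 · support · rank 9 · closed · proved by Summit.AtomisticToContinuum.Crystallization.Theorems.chargedPeriodicIsOptimal_proof (prover) · by planner
sources: BlancLewin2015
[support] (card item A3, SURGERY-ATTAINMENT; conjunct (i) from a support statement) if a periodic
configuration Q is charged by some sequence of LJ ground states with positive density at every scale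
(the conclusion of GroundStatesChargePeriodic for this Q), then e(Q) is the least value of the
energy per particle over all periodic configurations. Proof sketch: if e(Q') < e(Q), pick R ≫
1/(e(Q) − e(Q')) and ε small; along the infinitely many N with ≥ ρN good particles select ≥ ρN/(C
R³) disjoint good R-balls (hard-core packing bound, in tree), excise each patch (n ≈ |Q ∩ B_R|
particles, self-energy ≥ n e(Q) − Cεn − CR², cross terms ≥ −CR² by the r⁻⁶ tail and
LennardJonesMinimalDistance) and insert a Q'-patch of radius R − 1 with n' ≤ n particles (margin 1 ⇒
all new cross terms ≤ 0); compare E(N') ≤ E_mod with E(M)/M → e_∞ (BlancLewin2015_8_holds, proved)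
and e_∞ ≤ e(Q') (trial states, 0629): 0 ≤ k[(n' − n)(e(Q') − e_∞) − n(e(Q) − e(Q')) + CR² + Cεn] +
o(N) with k ≥ cρN/R³ is absurd for R large. No Wulff shapes, no rates. [difficulty: M] -/
@[route_item "route-AtomisticToContinuum-HolmgrenBoyleLind", crux]
def ChargedPeriodicIsOptimal : Prop :=
  ∀ Q : Literature.MathematicalPhysics.StatisticalMechanics.PeriodicConfiguration 3, (∃ x : (N : ℕ) → (Fin N → EuclideanSpace ℝ (Fin 3)), (∀ N, Literature.MathematicalPhysics.StatisticalMechanics.IsGroundState Literature.MathematicalPhysics.StatisticalMechanics.lennardJones (x N)) ∧ ∀ R ε : ℝ, 0 < R → 0 < ε → ∃ ρ : ℝ, 0 < ρ ∧ ∃ᶠ N : ℕ in Filter.atTop, ρ * (N : ℝ) ≤ (Nat.card {i : Fin N // ∃ A : EuclideanSpace ℝ (Fin 3) →ₗᵢ[ℝ] EuclideanSpace ℝ (Fin 3), ∃ q ∈ Q.points, (∀ s ∈ Q.points, dist s q ≤ R → ∃ j : Fin N, dist (x N j) (x N i + A (s - q)) ≤ ε) ∧ (∀ j : Fin N, dist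 (x N j) (x N i) ≤ R → ∃ s ∈ Q.points, dist (x N j) (x N i + A (s - q)) ≤ ε)} : ℝ)) → IsLeast (Set.range fun Q' : Literature.MathematicalPhysics.StatisticalMechanics.PeriodicConfiguration 3 => Q'.energyPerParticle Literature.MathematicalPhysics.StatisticalMechanics.lennardJones) (Q.energyPerParticle Literature.MathematicalPhysics.StatisticalMechanics.lennardJones)

/-- `ChargedPeriodicIsOptimal` holds: proved by `Summit.AtomisticToContinuum.Crystallization.Theorems.chargedPeriodicIsOptimal_proof`. -/
theorem ChargedPeriodicIsOptimal_holds : ChargedPeriodicIsOptimal := _root_.Summit.AtomisticToContinuum.Crystallization.Theorems.chargedPeriodicIsOptimal_proof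

/-- item stmt-AtomisticToContinuum-2916 · support · rank 9 · closed · proved by Summit.AtomisticToContinuum.Crystallization.Theorems.chargedPatternCrystallizes_proof (prover) · by planner
sources: BlancLewin2015
[support] (soft) GroundStatesChargePeriodic → LennardJonesMinimalDistance → IsCrystallizing
lennardJones 3: choose scales (k, 1/k), indices N_k ↑ with a good particle i_k, isometries A_k → A
along a subsequence (compactness of O(3)), τ_k := −x_(i_k) + alignment; the two-way matching with
minimal distance is eventually exact near every compact set, so
PeriodicConfiguration.tendsto_sum_of_eventually_near' (in tree) gives local convergence to the
periodic configuration A(Q − q) (isometryImage/translate in CrystallizationSymmetries), multiplicity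
1. [difficulty: M] -/
@[route_item "route-AtomisticToContinuum-HolmgrenBoyleLind", crux]
def ChargedPatternCrystallizes : Prop :=
  GroundStatesChargePeriodic → Literature.MathematicalPhysics.StatisticalMechanics.LennardJonesMinimalDistance → Literature.MathematicalPhysics.StatisticalMechanics.IsCrystallizing Literature.MathematicalPhysics.StatisticalMechanics.lennardJones 3

/-- `ChargedPatternCrystallizes` holds: proved by `Summit.AtomisticToContinuum.Crystallization.Theorems.chargedPatternCrystallizes_proof`. -/
theorem ChargedPatternCrystallizes_holds : ChargedPatternCrystallizes := _root_.Summit.AtomisticToContinuum.Crystallization.Theorems.chargedPatternCrystallizes_proof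

/-- item stmt-AtomisticToContinuum-6078 · support · rank 9 · closed · proved by Summit.AtomisticToContinuum.Crystallization.Theorems.HolmgrenBoyleLind.finiteRigidity_proof @ 7c31a3b0725b (prover) · by planner
sources: BlancLewin2015, HormanderALPDO1
[support] (card item U1, «a local rearrangement cannot hide from infinity») if Λ ⊂ ℝ³ is
δ-separated, r-dense and in exact LJ force balance and Λ' ≠ Λ differs from Λ in finitely many
points, then some point of Λ' is NOT in force balance in Λ'. Proof: the force difference Φ of the
finite signed source Λ'ΔΛ is real-analytic off the sources with a convergent expansion Σ_(n≥7) H_n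
in terms homogeneous of degree −n for |x| large (binomial series of |x−y|^(−s)); if every point of
Λ' were balanced, Φ would vanish on the Delone set Λ ∩ Λ' near infinity, and since every direction
is a limit direction the H_n die one by one, so Φ ≡ 0 near infinity and hence on the connected set
ℝ³ ∖ (Λ'ΔΛ) (identity theorem, Mathlib AnalyticOnNhd.eqOn_zero_of_preconnected_of_eventuallyEq_zero)
— contradicting the uncancelled r⁻¹³ core at a source. Fails exactly for finite-range V (no
continuation past the cut-off) and for band-limited potentials (no inverse-power expansion, no
core): the catalogue's two aperiodic-ground-state classes. [difficulty: M] -/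
@[route_item "route-AtomisticToContinuum-HolmgrenBoyleLind", crux]
def FiniteRigidity : Prop :=
  ∀ (Λ : Set (EuclideanSpace ℝ (Fin 3))) (δ r : ℝ), 0 < δ → 0 < r → (∀ x ∈ Λ, ∀ y ∈ Λ, x ≠ y → δ ≤ dist x y) → (∀ c : EuclideanSpace ℝ (Fin 3), ∃ y ∈ Λ, dist y c ≤ r) → (∀ x ∈ Λ, HasSum (fun y : {y : EuclideanSpace ℝ (Fin 3) // y ∈ Λ ∧ y ≠ x} => (deriv Literature.MathematicalPhysics.StatisticalMechanics.lennardJones (dist x (y : EuclideanSpace ℝ (Fin 3))) / dist x (y : EuclideanSpace ℝ (Fin 3))) • (x - (y : EuclideanSpace ℝ (Fin 3)))) 0) → ∀ Λ' : Set (EuclideanSpace ℝ (Fin 3)), ((Λ' \ Λ) ∪ (Λ \ Λ')).Finite → Λ' ≠ Λ → ∃ x ∈ Λ', ¬ HasSum (fun y : {y : EuclideanSpace ℝ (Fin 3) // y ∈ Λ' ∧ y ≠ x} => (deriv Literature.MathematicalPhysics.StatisticalMechanics.lennardJones (dist x (y : EuclideanSpace ℝ (Fin 3))) / dist x (y : EuclideanSpace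 ℝ (Fin 3))) • (x - (y : EuclideanSpace ℝ (Fin 3)))) 0

/-- item stmt-AtomisticToContinuum-6079 · support · rank 9 · open · by planner
sources: BoyleLind1997, KellendonkLenz2013, BaakeGrimm2013
[support] (the card's headline Literature theorem; it is the glue UC → HSR → this, sorry-free in the
planner's SketchProofs.lean, so it closes when UC and HSR close and may be attacked directly) every
δ-separated, r-dense subset of ℝ³ of finite local complexity in exact Lennard-Jones force balance is
the point set of a periodic configuration. Corollaries: ideal icosahedral model sets,
substitution/cut-and-project vertex sets, Wang-tile decorations of lattices and ideal aperiodic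
close-packed (kissing-12) stackings are never in LJ mechanical equilibrium; relaxed aperiodic
stackings are equilibria but not FLC (the card's foil), which fixes the scope. [difficulty: XL] -/
@[route_item "route-AtomisticToContinuum-HolmgrenBoyleLind", crux]
def FLCEquilibriumPeriodic : Prop :=
  ∀ (Λ : Set (EuclideanSpace ℝ (Fin 3))) (δ r : ℝ), 0 < δ → 0 < r → (∀ x ∈ Λ, ∀ y ∈ Λ, x ≠ y → δ ≤ dist x y) → (∀ c : EuclideanSpace ℝ (Fin 3), ∃ y ∈ Λ, dist y c ≤ r) → (∀ R : ℝ, Set.Finite {S : Set (EuclideanSpace ℝ (Fin 3)) | ∃ x ∈ Λ, S = {v : EuclideanSpace ℝ (Fin 3) | x + v ∈ Λ ∧ ‖v‖ ≤ R}}) → (∀ x ∈ Λ, HasSum (fun y : {y : EuclideanSpace ℝ (Fin 3) // y ∈ Λ ∧ y ≠ x} => (deriv Literature.MathematicalPhysics.StatisticalMechanics.lennardJones (dist x (y : EuclideanSpace ℝ (Fin 3))) / dist x (y : EuclideanSpace ℝ (Fin 3))) • (x - (y : EuclideanSpace ℝ (Fin 3)))) 0) → ∃ P : Literature.MathematicalPhysics.StatisticalMechanics.PeriodicConfiguration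 3, P.points = Λ

/-- item stmt-AtomisticToContinuum-6080 · assembly · rank 1 · closed · proved by Summit.AtomisticToContinuum.Crystallization.Theorems.holmgrenBoyleLind_assembly_proof @ ce8b0759f6fe (prover) · by planner
sources: BlancLewin2015, BoyleLind1997
[assembly] HalfSpaceUniqueContinuation → HalfSpaceRigidityPeriodic →
GroundStatesChargeFLCEquilibrium → ChargedPeriodicIsOptimal → ChargedPatternCrystallizes →
CrysEnergyLimit → Crystallization. -/
@[route_item "route-AtomisticToContinuum-HolmgrenBoyleLind", crux]
def Assembly : Prop :=
  HalfSpaceUniqueContinuation → HalfSpaceRigidityPeriodic → GroundStatesChargeFLCEquilibrium → ChargedPeriodicIsOptimal → ChargedPatternCrystallizes → CrysEnergyLimit → Crystallization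

/-! D-0027 §2.1 — DECIDING THEOREM (planner-authored via `route open/edit --closes-file`; by planner-rbadge-AtomisticToContinuum-HolmgrenBo-b506767e-g2-0 2026-08-15T16:14:55Z):
its hypotheses are this route's items and its conclusion the sub-problem Statement (glue_lint), and it elaborates with this file. -/

@[closes "route-AtomisticToContinuum-HolmgrenBoyleLind"] theorem closes : HalfSpaceUniqueContinuation → GroundStatesChargeFLCEquilibrium → HalfSpaceRigidityPeriodic → CrysEnergyLimit → GroundStatesChargePeriodic → ChargedPeriodicIsOptimal → ChargedPatternCrystallizes → FiniteRigidity → FLCEquilibriumPeriodic → Assembly → _root_.Crystallization := by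
  intro hUC hLIM hHSR hLim _hGCP hOpt hCryst _hFR _hFLCP _hA
  -- the hinge `GroundStatesChargePeriodic`, DERIVED from the three cruxes LIM, UC, HSR
  have hGCP : GroundStatesChargePeriodic := by
    intro x hx
    obtain ⟨Λ, δ, r, hδ, hr, hsep, hden, hFLC, hbal, hch⟩ := hLIM x hx
    obtain ⟨P, hP⟩ := hHSR Λ δ r hδ hr hsep hden hFLC (hUC Λ δ r hδ hr hsep hden hFLC hbal)
    subst hP
    exact ⟨P, hch⟩
  show Literature.MathematicalPhysics.StatisticalMechanics.HasPeriodicGroundStateEnergy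
      Literature.MathematicalPhysics.StatisticalMechanics.lennardJones 3 ∧
    Literature.MathematicalPhysics.StatisticalMechanics.IsCrystallizing
      Literature.MathematicalPhysics.StatisticalMechanics.lennardJones 3
  refine ⟨?_, hCryst hGCP
    Literature.MathematicalPhysics.StatisticalMechanics.LennardJonesMinimalDistance_holds⟩
  -- energetic half: a ground-state sequence exists, its charged `Q` is optimal, and `⨅ = e(Q)`
  choose x hx using
    (show ∀ N : ℕ, ∃ y : Fin N → EuclideanSpace ℝ (Fin 3),
        Literature.MathematicalPhysics.StatisticalMechanics.IsGroundState
          Literature.MathematicalPhysics.StatisticalMechanics.lennardJones y from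
      Literature.MathematicalPhysics.StatisticalMechanics.LennardJonesGroundStatesExist_holds)
  obtain ⟨Q, hQ⟩ := hGCP x hx
  have hleast := hOpt Q ⟨x, hx, hQ⟩
  refine ⟨Q, hleast, ?_⟩
  have h1 : (⨅ Q' : Literature.MathematicalPhysics.StatisticalMechanics.PeriodicConfiguration 3,
      Q'.energyPerParticle Literature.MathematicalPhysics.StatisticalMechanics.lennardJones) =
      Q.energyPerParticle Literature.MathematicalPhysics.StatisticalMechanics.lennardJones :=
    hleast.csInf_eq
  rw [← h1]
  exact hLim

end Summit.AtomisticToContinuum.Crystallization.Theses.HolmgrenBoyleLind
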